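import Literature.NumberTheory.Weil1964.ArchSchrodingerFollandDictionary
import HarnessLib

/-!
# Folland coordinates on the archimedean phase space: bijectivity and the covariance in `(p, q)`-form

Origin: `pub-hodgecm` MODEL-CONSTRUCTION sub-cell, node W2-⊗ (⊗S)-𝔸 (iii)(d1b), first half. KERNEL MATHEMATICS ONLY:
no `def … : Prop` records, no `axiom`, no proof hole.

`ArchSchrodingerFollandDictionary` proves the covariance of the archimedean factor `A` of an implementer in the
PARAMETRISED form `A ρ_D(e a, follandFreq e (T_∞ w)) = follandCocycle • ρ_D(e a′, follandFreq e (T_∞ w′)) A`.  The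
two-factor Schur lemma (`SegalBargmann.exists_ne_zero_smul_piBoxTensor_proj`) wants it for ALL `(p, q) ∈ ℝ^σ × ℝ^σ`
with a self-map `s` and a cocycle `χ`.  This file supplies the change of variables:

* §1 `follandFreqₗ e` is a linear ISOMORPHISM `(ι → F ⊗ ℝ) ≃ₗ[ℝ] (σ → ℝ)` (the trace pairing is nondegenerate,
  `piTracePairing_nondegenerate`, and `e` is an isomorphism; `follandFreqEquiv`), and for `T` with `IsUnit (archMat T)`
  the map `archFolland T e : (a, w) ↦ (e a, follandFreq e (T_∞ w))` is a bijection (`archFolland_bijective`);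
* §2 the induced phase-space map `archPhaseMap T e g := Ξ ∘ archAct g ∘ Ξ⁻¹` and cocycle `archCocycle T e g :=
  follandCocycle ∘ Ξ⁻¹` (`Ξ = archFolland T e`, nowhere zero), and **`arch_covariant_rhoSD_all`**:
  `∀ p q Φ, A (rhoSD e p q Φ) = archCocycle (p,q) • rhoSD e (archPhaseMap (p,q)).1 (archPhaseMap (p,q)).2 (A Φ)`.

All phases come from `adeleAddChar` / `archLinChar` and Folland's `rhoMul` through the imported dictionary; nothing is
re-chosen here.

## References
* [Folland1989] G. B. Folland, *Harmonic Analysis in Phase Space*, Princeton UP (1989), §1.3 (1.25).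
* [Weil1964] A. Weil, *Sur certains groupes d'opérateurs unitaires*, Acta Math. 111 (1964), n° 4–5.

## Provenance

LEAN-IN-TREE rule (2026-08-18), pub-hodgecm model-construction sub-cell, seat mc-binder-2 gen 3 ((⊗S)-𝔸 (iii)(d1b)).
-/

set_option autoImplicit false

noncomputable section

open scoped Matrix SchwartzMap TensorProduct Real Classical
open Complex NumberField NumberField.mixedEmbedding IsDedekindDomain
open Literature.NumberTheory.Automorphic Literature.RepresentationTheory.HeisenbergGroup
open Literature.Analysis.SegalBargmann

namespace Literature.NumberTheory.Weil1964

variable {F : Type} [Field F] [NumberField F] {ι : Type} [Fintype ι] {σ : Type*}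

/-! ## §1 `follandFreq e` is an isomorphism; `archFolland T e` is a bijection -/

section Coordinates

variable (F ι) in
/-- `follandFreq e` as a real-linear map `(ι → F ⊗ ℝ) →ₗ[ℝ] (σ → ℝ)`. [folklore] -/
def follandFreqₗ (e : (ι → mixedSpace F) ≃L[ℝ] (σ → ℝ)) : (ι → mixedSpace F) →ₗ[ℝ] (σ → ℝ) where
  toFun := follandFreq F ι e
  map_add' w w' := follandFreq_add e w w'
  map_smul' c w := by
    funext k
    simp only [follandFreq, map_smul, smul_eq_mul, Pi.smul_apply, RingHom.id_apply, mul_neg]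

/-- Unfolding. [folklore] -/
@[simp] theorem follandFreqₗ_apply (e : (ι → mixedSpace F) ≃L[ℝ] (σ → ℝ)) (w : ι → mixedSpace F) :
    follandFreqₗ F ι e w = follandFreq F ι e w := rfl

variable [Fintype σ]

/-- **`follandFreq e` is injective** (the trace pairing is nondegenerate). [folklore] -/
theorem follandFreq_injective (e : (ι → mixedSpace F) ≃L[ℝ] (σ → ℝ)) :
    Function.Injective (follandFreq F ι e) := by
  intro w w' h
  have hpair : ∀ u, piTracePairing F ι u w = piTracePairing F ι u w' := fun u => by
    have h1 := follandFreq_dotProduct_apply e w u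
    have h2 := follandFreq_dotProduct_apply e w' u
    rw [h] at h1
    linarith
  -- nondegeneracy in the second slot via symmetry
  have hsub : ∀ u, piTracePairing F ι (w - w') u = 0 := fun u => by
    rw [map_sub, LinearMap.sub_apply, piTracePairing_comm w u, piTracePairing_comm w' u, hpair u, sub_self]
  exact sub_eq_zero.mp ((piTracePairing_nondegenerate F ι).1 (w - w') hsub)

/-- **`follandFreq e` is surjective**: every `q ∈ ℝ^σ` is the frequency vector of the `w` representing the functional
`u ↦ −q · (e u)` for the (perfect) trace pairing. [folklore] -/
theorem follandFreq_surjective (e : (ι → mixedSpace F) ≃L[ℝ] (σ → ℝ)) :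
    Function.Surjective (follandFreq F ι e) := by
  intro q
  let f : Module.Dual ℝ (ι → mixedSpace F) :=
    { toFun := fun u => -(q ⬝ᵥ e u)
      map_add' := fun u v => by rw [map_add, dotProduct_add, neg_add]
      map_smul' := fun c u => by rw [map_smul, dotProduct_smul, smul_eq_mul, RingHom.id_apply, smul_eq_mul, mul_neg] }
  refine ⟨((piTracePairing F ι).toDual (piTracePairing_nondegenerate F ι)).symm f, funext fun k => ?_⟩
  rw [follandFreq, piTracePairing_comm, LinearMap.BilinForm.apply_toDual_symm_apply]
  show -(-(q ⬝ᵥ e (e.symm (Pi.single k 1)))) = q k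
  rw [neg_neg, ContinuousLinearEquiv.apply_symm_apply, dotProduct_single, mul_one]

variable (F ι) in
/-- **`follandFreq e` as a linear isomorphism** `(ι → F ⊗ ℝ) ≃ₗ[ℝ] (σ → ℝ)`. [folklore] -/
def follandFreqEquiv (e : (ι → mixedSpace F) ≃L[ℝ] (σ → ℝ)) : (ι → mixedSpace F) ≃ₗ[ℝ] (σ → ℝ) :=
  LinearEquiv.ofBijective (follandFreqₗ F ι e) ⟨follandFreq_injective e, follandFreq_surjective e⟩

/-- Unfolding. [folklore] -/
@[simp] theorem follandFreqEquiv_apply (e : (ι → mixedSpace F) ≃L[ℝ] (σ → ℝ)) (w : ι → mixedSpace F) :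
    follandFreqEquiv F ι e w = follandFreq F ι e w := rfl

variable (T : Matrix ι ι (AdeleRing (𝓞 F) F))

/-- **The Folland coordinates of an archimedean phase-space pair**:
`archFolland T e (a, w) := (e a, follandFreq e (T_∞ w))`. [folklore] -/
def archFolland (e : (ι → mixedSpace F) ≃L[ℝ] (σ → ℝ)) (aw : (ι → mixedSpace F) × (ι → mixedSpace F)) :
    (σ → ℝ) × (σ → ℝ) :=
  (e aw.1, follandFreq F ι e (archMat F ι T *ᵥ aw.2))

omit [Fintype σ] in
/-- Unfolding. [folklore] -/
@[simp] theorem archFolland_apply (e : (ι → mixedSpace F) ≃L[ℝ] (σ → ℝ)) (a w : ι → mixedSpace F) :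
    archFolland T e (a, w) = (e a, follandFreq F ι e (archMat F ι T *ᵥ w)) := rfl

omit [Fintype σ] in
/-- First component. [folklore] -/
@[simp] theorem archFolland_fst (e : (ι → mixedSpace F) ≃L[ℝ] (σ → ℝ)) (aw : (ι → mixedSpace F) × (ι → mixedSpace F)) :
    (archFolland T e aw).1 = e aw.1 := rfl

omit [Fintype σ] in
/-- Second component. [folklore] -/
@[simp] theorem archFolland_snd (e : (ι → mixedSpace F) ≃L[ℝ] (σ → ℝ)) (aw : (ι → mixedSpace F) × (ι → mixedSpace F)) :
    (archFolland T e aw).2 = follandFreq F ι e (archMat F ι T *ᵥ aw.2) := rfl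

variable [DecidableEq ι]

/-- Multiplication by an invertible matrix is a bijection of `ι → R`. [folklore] -/
theorem mulVec_bijective_of_isUnit {R : Type*} [CommRing R] {N : Matrix ι ι R} (hN : IsUnit N) :
    Function.Bijective fun v : ι → R => N *ᵥ v := by
  obtain ⟨u, rfl⟩ := hN
  refine ⟨fun v v' h => ?_, fun v => ⟨(↑u⁻¹ : Matrix ι ι R) *ᵥ v, ?_⟩⟩
  · have h1 := congrArg (fun x => (↑u⁻¹ : Matrix ι ι R) *ᵥ x) h
    simpa only [Matrix.mulVec_mulVec, Units.inv_mul, Matrix.one_mulVec] using h1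
  · show (↑u : Matrix ι ι R) *ᵥ ((↑u⁻¹ : Matrix ι ι R) *ᵥ v) = v
    rw [Matrix.mulVec_mulVec, Units.mul_inv, Matrix.one_mulVec]

/-- `archMat` is the entrywise image under the ring homomorphism `𝔸_F → F_∞ ≅ F ⊗ ℝ`. [folklore] -/
theorem archMat_eq_mapMatrix :
    archMat F ι T = ((InfiniteAdeleRing.ringEquiv_mixedSpace F).toRingHom.comp
      (RingHom.fst (InfiniteAdeleRing F) (FiniteAdeleRing (𝓞 F) F))).mapMatrix T := rfl

/-- **An invertible adelic matrix has invertible archimedean part** (`archMat` is a ring homomorphism entrywise).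
[folklore] -/
theorem isUnit_archMat_of_isUnit (hT : IsUnit T) : IsUnit (archMat F ι T) := by
  rw [archMat_eq_mapMatrix]
  exact hT.map _

/-- **`archFolland T e` is a bijection** when the archimedean part `T_∞` of `T` is invertible. [folklore] -/
theorem archFolland_bijective (e : (ι → mixedSpace F) ≃L[ℝ] (σ → ℝ)) (hT : IsUnit (archMat F ι T)) :
    Function.Bijective (archFolland T e) := by
  have hb := (follandFreqEquiv F ι e).bijective.comp (mulVec_bijective_of_isUnit hT)
  refine ⟨fun x y h => ?_, fun pq => ?_⟩
  · exact Prod.ext (e.injective (congrArg Prod.fst h)) (hb.1 (congrArg Prod.snd h))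
  · obtain ⟨a, ha⟩ := e.surjective pq.1
    obtain ⟨w, hw⟩ := hb.2 pq.2
    exact ⟨(a, w), Prod.ext ha hw⟩

end Coordinates

/-! ## §2 The phase-space map and cocycle in Folland coordinates; covariance for all `(p, q)` -/

section AllPQ

variable [Fintype σ] [DecidableEq ι] (T : Matrix ι ι (AdeleRing (𝓞 F) F)) (e : (ι → mixedSpace F) ≃L[ℝ] (σ → ℝ))
  (hT : IsUnit (archMat F ι T))

/-- The inverse Folland coordinates (a genuine two-sided inverse when `IsUnit (archMat T)`). [folklore] -/
def archFollandInv (pq : (σ → ℝ) × (σ → ℝ)) : (ι → mixedSpace F) × (ι → mixedSpace F) :=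
  Function.surjInv (archFolland_bijective T e hT).2 pq

/-- `Ξ (Ξ⁻¹ pq) = pq`. [folklore] -/
@[simp] theorem archFolland_archFollandInv (pq : (σ → ℝ) × (σ → ℝ)) :
    archFolland T e (archFollandInv T e hT pq) = pq :=
  Function.surjInv_eq (archFolland_bijective T e hT).2 pq

/-- `Ξ⁻¹ (Ξ aw) = aw`. [folklore] -/
@[simp] theorem archFollandInv_archFolland (aw : (ι → mixedSpace F) × (ι → mixedSpace F)) :
    archFollandInv T e hT (archFolland T e aw) = aw :=
  Function.leftInverse_surjInv (archFolland_bijective T e hT) aw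

/-- **The archimedean action of `g` in Folland coordinates**: `archPhaseMap T e g := Ξ ∘ archAct g ∘ Ξ⁻¹`. [folklore] -/
def archPhaseMap (g : symplecticGroup (polar (adelicForm F ι T))) (pq : (σ → ℝ) × (σ → ℝ)) :
    (σ → ℝ) × (σ → ℝ) :=
  archFolland T e (archAct T g (archFollandInv T e hT pq))

/-- **The cocycle of `g` in Folland coordinates**: `archCocycle T e g := follandCocycle T e g ∘ Ξ⁻¹`. [folklore] -/
def archCocycle (g : symplecticGroup (polar (adelicForm F ι T))) (pq : (σ → ℝ) × (σ → ℝ)) : ℂ :=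
  follandCocycle T e g (archFollandInv T e hT pq)

/-- On Folland coordinates of an archimedean pair the phase-space map is `Ξ (archAct g (a, w))`. [folklore] -/
theorem archPhaseMap_archFolland (g : symplecticGroup (polar (adelicForm F ι T)))
    (aw : (ι → mixedSpace F) × (ι → mixedSpace F)) :
    archPhaseMap T e hT g (archFolland T e aw) = archFolland T e (archAct T g aw) := by
  rw [archPhaseMap, archFollandInv_archFolland]

/-- On Folland coordinates of an archimedean pair the cocycle is `follandCocycle`. [folklore] -/
theorem archCocycle_archFolland (g : symplecticGroup (polar (adelicForm F ι T)))
    (aw : (ι → mixedSpace F) × (ι → mixedSpace F)) :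
    archCocycle T e hT g (archFolland T e aw) = follandCocycle T e g aw := by
  rw [archCocycle, archFollandInv_archFolland]

/-- The cocycle vanishes nowhere. [folklore] -/
theorem archCocycle_ne_zero (g : symplecticGroup (polar (adelicForm F ι T))) (pq : (σ → ℝ) × (σ → ℝ)) :
    archCocycle T e hT g pq ≠ 0 :=
  follandCocycle_ne_zero T e g _

/-- **Projective Folland covariance of the archimedean factor, for ALL `(p, q)`**: the `hA_j` / `hM` hypothesis shape
of `SegalBargmann.exists_ne_zero_smul_piBoxTensor_proj`. [cite: Folland1989, Prop. (1.43)] -/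
theorem arch_covariant_rhoSD_all (g : symplecticGroup (polar (adelicForm F ι T)))
    (M : piSchwartzBruhat F ι ≃ₗ[ℂ] piSchwartzBruhat F ι)
    (hM : Implements (adelicSchrodinger F ι T) (ofSymplectic (polar (adelicForm F ι T)) g) M)
    (A : 𝓢((ι → mixedSpace F), ℂ) →ₗ[ℂ] 𝓢((ι → mixedSpace F), ℂ)) (Mf : FinSB F ι →ₗ[ℂ] FinSB F ι)
    (hAM : ∀ (Φ : 𝓢((ι → mixedSpace F), ℂ)) (f : FinSB F ι),
      M (piSchwartzBruhatEquiv F ι (Φ ⊗ₜ f)) = piSchwartzBruhatEquiv F ι (A Φ ⊗ₜ Mf f))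
    {f₀ : FinSB F ι} (hf₀ : Mf f₀ ≠ 0) (p q : σ → ℝ) (Φ : 𝓢((ι → mixedSpace F), ℂ)) :
    A (rhoSD e p q Φ) =
      archCocycle T e hT g (p, q) •
        rhoSD e (archPhaseMap T e hT g (p, q)).1 (archPhaseMap T e hT g (p, q)).2 (A Φ) := by
  obtain ⟨⟨a, w⟩, haw⟩ := (archFolland_bijective T e hT).2 (p, q)
  have hp := congrArg Prod.fst haw
  have hq := congrArg Prod.snd haw
  simp only [archFolland_fst, archFolland_snd] at hp hq
  subst hp
  subst hq
  rw [show (e a, follandFreq F ι e (archMat F ι T *ᵥ w)) = archFolland T e (a, w) from rfl, archCocycle_archFolland,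
    archPhaseMap_archFolland, archFolland_fst, archFolland_snd]
  exact arch_covariant_rhoSD_of_implements T e g M hM A Mf hAM hf₀ a w Φ

end AllPQ

end Literature.NumberTheory.Weil1964

end
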